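import Summits.QuantumFields.YangMills.Theorems.FluctuationComparisonRegPrIntLOrganTangentFibreMeanTools
import Literature.MathematicalPhysics.QuantumFieldTheory.Balaban1983to89.Node00.RegSetOfFibredChart
import Literature.MathematicalPhysics.QuantumFieldTheory.Balaban1983to89.T3UnitScaleTilt
import Literature.MathematicalPhysics.QuantumFieldTheory.Balaban1983to89.T3OrbitAverage
import HarnessLib

/-!
# Crux `FluctuationComparisonRegPrIntL` (stmt-QuantumFields-20520, rung R3), PATH-B organ O1, LINE g25-3 «version_coarea», row COAREA∘
# `RegularFibrePackageCan` — SUPPORT LEMMA «THE COARSE HAAR MEASURE ON THE WINDOW IS ABSOLUTELY CONTINUOUS W.R.T. THE PUSH-FORWARD OF THE FINE ONE»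
# from the fibred-chart letters (`hmap` + chart mass), i.e. the TRANSFER «`descend_* dU_{j+1}`-a.e. ⇒ `dU_j`-a.e. on the window» that COAREA∘'s
# `dU_j`-a.e. DISINT clause needs and the (A)-package (one `σ₀`, `ν`-a.e.) does not export (LEAD WORD №10 (α), step (t))

LEAD-20520 width seat ym-ust-20520-w3 g23 (cell ym3-torus), `--supports stmt-QuantumFields-20520` (helper).  THEOREMS ONLY, def-free.

§1 ★`restrict_absolutelyContinuous_map_of_fibredChart` — GENERIC (`α β Z`, s-finite `μ τ`): a fibred chart `(Z, τ, Φ, J, S)` of `avg : β → α` over a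
measurable `U ⊆ α` (`havgΦ : avg (Φ (V,z)) = V` on `U`, `hmap : ν|_{avg⁻¹U ∩ S} = Φ_*(J·(μ|_U ⊗ τ))` — the binders of
✓`Node00.RegSetOfFibredChart.integral_mul_comp_eq_integral_fibreIntegral_mul`) whose fibres all have POSITIVE chart mass (`0 < ∫⁻ J(V,·) dτ` for `V ∈ U`)
forces `μ|_U ≪ avg_* ν`: a `ν`-null `avg`-saturated set has `J·(μ|_U ⊗ τ)`-null chart preimage `A × Z` (Tonelli), so `∫⁻_A (∫⁻ J dτ) dμ|_U = 0` with a
positive integrand, whence `μ|_U(A) = 0`.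
§2 ★`restrict_window_absolutelyContinuous_map_descend` — the T³ reading at the binders of ✓BRIDGE′∕BRIDGE′c (`havgΦ`, `hmap`, `hmass` over the coarse window
`{PlaqSmall θ_j}`; the `cW`-window chart mass implies the full chart mass): `(dU_j)|_{window} ≪ descend_* dU_{j+1}`.  With it, every `ν`-a.e.-on-the-window
statement of the (A)-package∕uniqueness kind becomes a `dU_j`-a.e. statement WITHOUT a density frame (cf. ✓KNIT's `ae_on_of_ae_map_of_withDensity_eq`, which needs
the towers' densities).  Instantiating §2 from a height (the chart of ✓TRIc fed by ✓(L7) `oneBondLaw`, as ✓(L8) does for the package) is the remaining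
step (t) of COAREA∘-closed; steps (u) uniqueness and (s) separability are separate.

HONEST FRAMING: measure theory over chart letters; nothing of Bałaban's analysis is asserted or proved; COAREA∘, VER∘'s siblings, LIN∘, JEN∘, O1, crux 20520,
`YM3TorusSU2` are NOT proved here; registry `Lines/semiclassical_s2beta.lean` v11.4 (★★OWNER RULING №36) untouched; rung R3 = SU(2) YM₃ on T³ — NOT d = 4,
NOT infinite volume, NOT a mass gap, NOT Clay; the Yang–Mills mass gap is NOT proved by any of this.
-/

set_option autoImplicit false

noncomputable section

namespace Summit.QuantumFields.YangMills.Theorems.OrganTangentWindowAbsCont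

open MeasureTheory Filter Topology Set
open scoped ENNReal NNReal
open Literature.MathematicalPhysics.QuantumFieldTheory.Balaban1983to89
open T3ContinuumYM3Torus T3NestedUnitLaws T3UnitLawDensityEML T3UnitScaleTilt

/-! ## §1 Generic: positive chart mass on every fibre ⟹ `μ|_U ≪ avg_* ν` -/

/-- ★ **A fibred chart with positive fibre masses makes the base measure on the charted set absolutely continuous w.r.t. the push-forward.**
[folklore] [cite: Balaban1985Averaging, (10)-(13) p.19] -/
theorem restrict_absolutelyContinuous_map_of_fibredChart
    {α β Z : Type*} [MeasurableSpace α] [MeasurableSpace β] [MeasurableSpace Z]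
    {μ : Measure α} {ν : Measure β} {τ : Measure Z} [SFinite μ] [SFinite τ]
    {U : Set α} (hU : MeasurableSet U) {avg : β → α} (havg : Measurable avg)
    {Φ : α × Z → β} (hΦ : Measurable Φ) {J : α × Z → ℝ≥0} (hJ : Measurable J) {S : Set β}
    (havgΦ : ∀ V ∈ U, ∀ z, avg (Φ (V, z)) = V)
    (hmap : ν.restrict (avg ⁻¹' U ∩ S) = (((μ.restrict U).prod τ).withDensity (fun p => (J p : ℝ≥0∞))).map Φ)
    (hmass : ∀ V ∈ U, 0 < ∫⁻ z, (J (V, z) : ℝ≥0∞) ∂τ) :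
    μ.restrict U ≪ ν.map avg := by
  refine Measure.AbsolutelyContinuous.mk fun A hA hA0 => ?_
  rw [Measure.map_apply havg hA] at hA0
  have hE : MeasurableSet (Φ ⁻¹' (avg ⁻¹' A)) := hΦ (havg hA)
  -- the chart preimage of the `ν`-null saturated set is `J·(μ|_U ⊗ τ)`-null
  have h1 : (((μ.restrict U).prod τ).withDensity (fun p => (J p : ℝ≥0∞))) (Φ ⁻¹' (avg ⁻¹' A)) = 0 := by
    have h := (Measure.restrict_apply_le (avg ⁻¹' U ∩ S) (avg ⁻¹' A)).trans hA0.le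
    rw [hmap, Measure.map_apply hΦ (havg hA)] at h
    exact nonpos_iff_eq_zero.mp h
  rw [withDensity_apply _ hE, ← lintegral_indicator hE,
    lintegral_prod _ ((hJ.coe_nnreal_ennreal.indicator hE).aemeasurable)] at h1
  -- Tonelli + `avg ∘ Φ (V, ·) = V`: the iterated integral is `∫⁻_{A} (∫⁻ J(V,·) dτ) dμ|_U`
  set m : α → ℝ≥0∞ := fun V => ∫⁻ z, (J (V, z) : ℝ≥0∞) ∂τ with hm
  have hmm : Measurable m := hJ.coe_nnreal_ennreal.lintegral_prod_right'
  have h2 : ∫⁻ V, A.indicator m V ∂(μ.restrict U) = 0 := by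
    rw [← h1]
    refine lintegral_congr_ae ?_
    filter_upwards [ae_restrict_mem hU] with V hV
    by_cases hVA : V ∈ A
    · rw [indicator_of_mem hVA, hm]
      refine lintegral_congr fun z => ?_
      have : (V, z) ∈ Φ ⁻¹' (avg ⁻¹' A) := by
        show avg (Φ (V, z)) ∈ A; rw [havgΦ V hV z]; exact hVA
      rw [indicator_of_mem this]
    · rw [indicator_of_notMem hVA]
      symm
      refine (lintegral_congr fun z => ?_).trans lintegral_zero
      have : (V, z) ∉ Φ ⁻¹' (avg ⁻¹' A) := by
        show avg (Φ (V, z)) ∉ A; rw [havgΦ V hV z]; exact hVA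
      simp only [indicator_of_notMem this]
  rw [lintegral_indicator hA] at h2
  -- a positive integrand with zero integral over `A`: `μ|_U (A) = 0`
  have h3 : ∀ᵐ V ∂((μ.restrict U).restrict A), m V = 0 :=
    (lintegral_eq_zero_iff hmm).mp h2
  have h4 : ∀ᵐ V ∂((μ.restrict U).restrict A), V ∈ U := ae_restrict_of_ae (ae_restrict_mem hU)
  have h5 : ((μ.restrict U).restrict A) univ = 0 := by
    have : ∀ᵐ V ∂((μ.restrict U).restrict A), False := by
      filter_upwards [h3, h4] with V h3V h4V
      exact (hmass V h4V).ne' h3V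
    rwa [ae_iff, show {a | ¬False} = (univ : Set α) from by ext; simp] at this
  rwa [Measure.restrict_apply MeasurableSet.univ, univ_inter] at h5

/-! ## §2 The T³ reading at the BRIDGE′ binders: `(dU_j)|_{window} ≪ descend_* dU_{j+1}` -/

/-- ★ **Window Haar is absolutely continuous w.r.t. the push-forward of fine Haar**, from the fibred-chart letters of ✓BRIDGE′c (`havgΦ`, `hmap`, the
`cW`-window chart mass `hmass`). [cite: Balaban1985Averaging, (10)-(13) p.19; Balaban1987RG1, (0.13) p.254] -/
theorem restrict_window_absolutelyContinuous_map_descend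
    (F : T3Family) (γ b₀ p₀ : ℝ) (j : ℕ) (cW : ℝ)
    {Z : Type*} [MeasurableSpace Z] (τ : Measure Z) [SFinite τ]
    (Φ : GaugeField (F.P j) 0 ↥(Matrix.specialUnitaryGroup (Fin 2) ℂ) × Z → GaugeField (F.P (j + 1)) 0 ↥(Matrix.specialUnitaryGroup (Fin 2) ℂ))
    (hΦ : Measurable Φ)
    (J : GaugeField (F.P j) 0 ↥(Matrix.specialUnitaryGroup (Fin 2) ℂ) × Z → ℝ≥0) (hJ : Measurable J)
    (S : Set (GaugeField (F.P (j + 1)) 0 ↥(Matrix.specialUnitaryGroup (Fin 2) ℂ)))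
    (havgΦ : ∀ V ∈ {V | PlaqSmall (θBal F.L γ b₀ p₀ j) V}, ∀ z, descend F ℰp j (Φ (V, z)) = V)
    (hmap : (fieldMeasure (F.P (j + 1)) 0 ↥(Matrix.specialUnitaryGroup (Fin 2) ℂ)).restrict
        (descend F ℰp j ⁻¹' {V | PlaqSmall (θBal F.L γ b₀ p₀ j) V} ∩ S) =
      ((((fieldMeasure (F.P j) 0 ↥(Matrix.specialUnitaryGroup (Fin 2) ℂ)).restrict {V | PlaqSmall (θBal F.L γ b₀ p₀ j) V}).prod τ).withDensity
        (fun p => (J p : ℝ≥0∞))).map Φ)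
    (hmass : ∀ V, PlaqSmall (θBal F.L γ b₀ p₀ j) V →
      0 < ∫⁻ z in {z | PlaqSmall (cW * θBal F.L γ b₀ p₀ (j + 1)) (Φ (V, z))}, (J (V, z) : ℝ≥0∞) ∂τ) :
    (fieldMeasure (F.P j) 0 ↥(Matrix.specialUnitaryGroup (Fin 2) ℂ)).restrict {V | PlaqSmall (θBal F.L γ b₀ p₀ j) V} ≪
      (fieldMeasure (F.P (j + 1)) 0 ↥(Matrix.specialUnitaryGroup (Fin 2) ℂ)).map (descend F ℰp j) := by
  haveI : BorelSpace (GaugeField (F.P j) 0 ↥(Matrix.specialUnitaryGroup (Fin 2) ℂ)) := T3OrbitAverage.instBorelSpaceGaugeField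
  have hWopen : IsOpen {V : GaugeField (F.P j) 0 ↥(Matrix.specialUnitaryGroup (Fin 2) ℂ) | PlaqSmall (θBal F.L γ b₀ p₀ j) V} := by
    have e : {V : GaugeField (F.P j) 0 ↥(Matrix.specialUnitaryGroup (Fin 2) ℂ) | PlaqSmall (θBal F.L γ b₀ p₀ j) V} =
        ⋂ p : Plaq (F.P j) 0, {V | dist1 (GaugeField.plaqHol V p) < θBal F.L γ b₀ p₀ j} := by
      ext V; simp only [PlaqSmall, Set.mem_setOf_eq, Set.mem_iInter]
    rw [e]
    exact isOpen_iInter_of_finite fun p => isOpen_lt (OrganTangentFibreMeanTools.continuous_dist1_plaqHol p) continuous_const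
  exact restrict_absolutelyContinuous_map_of_fibredChart hWopen.measurableSet (T3NestedUnitLaws.measurable_descend F ℰp measurableE_ℰp j)
    hΦ hJ havgΦ hmap fun V hV => (hmass V hV).trans_le (setLIntegral_le_lintegral _ _)

end Summit.QuantumFields.YangMills.Theorems.OrganTangentWindowAbsCont

end
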